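import Mathlib.NumberTheory.Real.Irrational
import Literature.Computability.QuantumComplexity.CliffordTPathSums
import Literature.Computability.Cryptography.Postselection
import HarnessLib

/-!
# Post-selected path sums for Clifford+T circuits: the exact sign of `2·Pr[11] − Pr[·1]`

Quantum half of the proof of `PostBQP ⊆ PP` (Aaronson 2005, Prop. 2: "we can use the same
observations used by Adleman, DeMarrais, and Huang to show that `BQP ⊆ PP`, but sum only over paths
where the first qubit is `|1⟩` at the end … we need to test which is greater: the sum `S₀` of
`α_z²` over all `z` beginning with `10`, or the sum `S₁` of `α_z²` over all `z` beginning with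
`11`"), for the tree's `PostBQP` (`Cryptography/Postselection.lean`: Clifford+`T`, output wire `0`,
post-selection wire `1`, thresholds `2/3`, `1/3`), continuing `CliffordTPathSums.lean` (paths
`pathRun`, the `ζ`-semantics `prodZeta ζ` with its Galois conjugate `ζ = ω⁵`, `pairSumA/B`,
`reA/reB`, `two_pow_mul_normSq_amp`).

The printed proof assumes Hadamard+Toffoli gates (Shi), so that all path contributions are dyadic
rationals. For Clifford+`T` the quantity to be signed, `u = 2^h (2·Pr[11] − Pr[·1]) = A + (√2/2)·B`
(`A`, `B` the event-weighted integer pair sums), is irrational, and — unlike in `BQP ⊆ PP`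
(`BQPSubsetPP.lean`), where the constant gap `1/3` lets `√2/2` be rounded to `3/4` — post-selection
probabilities may be as small as `2^{-Θ(h)}`, so the sign must be decided EXACTLY. This file does so
without changing the gate set: every path is prolonged by `k` extra *phase coins* (each coin `1`
multiplies the path amplitude by `ω`), which multiplies the complex pair sum by
`|(1+ω)^k|² = (2+√2)^k`, while its Galois conjugate (`ω ↦ ω⁵`, `√2 ↦ −√2`) is multiplied by
`(2−√2)^k`. The integer part `X` of `u·(2+√2)^k` then satisfies
`2X = u(2+√2)^k + u^σ(2−√2)^k` (`two_mul_extX_eq`) with `|u^σ| ≤ 2^h` (a signed probability of the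
unitary conjugate circuit) and `|u| ≥ 2^h·Pr[·1]/3 ≥ 1/(6·2^h)`: the lower bound
`2^h·Pr[·1] ≥ 1/2^{h+1}` (`two_pow_mul_prS_ge`) is the norm argument
`N(2^h Pr[·1]) = (2a² − b²)/2 ∈ ½ℤ ∖ {0}` (irrationality of `√2`) with `0 < conjugate ≤ 2^h`. Hence
`sign X = sign u` as soon as `(3+2√2)^k > 6·4^h`, e.g. `k ≥ h + 2` (`extX_pos`, `extX_neg`). The
weights `wtA ∈ {0, ±1}` summed in `X` are what the polynomial-time predicate of the sequel computes
on a guessed quadruple `(b, b', t, t')`; the counting assembly of `PostBQP ⊆ PP` is the third file.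

## Contents

* `pc` (popcount) and `sum_pow_pc : Σ_{t ∈ {0,1}^k} ξ^{pc t} = (1+ξ)^k`;
* the event weights `evWt z = [z₁ = 1]·(2[z₀ = 1] − 1)`, `psWt z = [z₁ = 1]` and the event
  probabilities `prS ζ` (`= Pr[·1]`), `prJ ζ` (`= Pr[11]`) of the `ζ`-semantics, `uval ζ c`
  (`= 2^h Σ_z c(z) |a_z|²`) with `uval_evWt`, `uval_psWt`, `uval_eq_cA_add_cB`;
* extended classes `extDiff`, weights `wtA`/`wtB`, complex terms `termExt`, the sums `extX`, `extY`,
  `Phi` and the **factorisation** `Phi_eq : Φ(ζ) = uval ζ c · ((1+ζ)(1+ζ⁷))^k`, `re_Phi`,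
  `extX_add_extY_omega`, `extX_sub_extY_omega5`, `two_mul_extX_eq`;
* bounds: `prJ_le_prS`, `prS_le_one`, `abs_uval_evWt_le`, `two_pow_mul_prS_ge`, `six_mul_lt`;
* the **sign theorem** `extX_pos` / `extX_neg`.

## References

* S. Aaronson, *Quantum computing, postselection, and probabilistic polynomial-time*, Proc. R.
  Soc. A 461 (2005) 3473–3482, doi:10.1098/rspa.2005.1546, arXiv:quant-ph/0412187: §3 Def. 1,
  Prop. 2 (`PostBQP ⊆ PP`) and its proof.
* L. M. Adleman, J. DeMarrais, M.-D. A. Huang, *Quantum computability*, SIAM J. Comput. 26 (1997)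
  1524–1540, §6 Lemma 6.10 (path-pair counting).
* M. A. Nielsen, I. L. Chuang, *Quantum Computation and Quantum Information*, CUP 2010, §4.2
  (`T = diag(1, e^{iπ/4})`), §2.2.5 (Born rule).

## Design notes

* Everything is stated for gate lists and a start label `w`, as in `CliffordTPathSums.lean`; the
  bridge to `QCircuitFamily.postselectProbOn` / `jointAcceptProbOn` is one `Finset.sum_filter` away
  (`prS`, `prJ` are literally the Born sums over `QCircuit.postselectEvent` / `jointAcceptEvent`) and
  is done in the assembly file.
* The irrationality step (`a + b√2/2 = 0 ⇒ a = b = 0`, cf. `ZW.int_add_int_mul_sqrt_two_half_eq_zero`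
  of `ZWRing.lean`) is re-proved inline (10 lines) inside `two_pow_mul_prS_ge` rather than imported,
  since the import closure of `ZWRing.lean` (`ControlledHadamard`, Forrelation files) is unrelated to
  this development.
-/

noncomputable section

namespace Literature.Computability.QuantumComplexity

open _root_.Computability Complexity Cryptography Matrix

namespace PostPP

variable {M : ℕ}

/-! ### Popcounts and the multiplier `(1 + ξ)^k` -/

/-- The number of ones of a coin block (each `1` prolongs a path by one factor `ω`). [folklore] -/
def pc (l : List Bool) : ℕ := l.count true

/-- `pc [] = 0`. [folklore] -/
@[simp] theorem pc_nil : pc [] = 0 := rfl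

/-- `pc (c :: l) = pc l + [c]`. [folklore] -/
theorem pc_cons (c : Bool) (l : List Bool) : pc (c :: l) = pc l + c.toNat := by
  cases c <;> simp [pc]

/-- **The multiplier as a coin sum**: `Σ_{t ∈ {0,1}^k} ξ^{pc t} = (1 + ξ)^k`. [folklore] -/
theorem sum_pow_pc (ξ : ℂ) (k : ℕ) : ∑ t : Fin k → Bool, ξ ^ pc (List.ofFn t) = (1 + ξ) ^ k := by
  induction k with
  | zero => simp [pc]
  | succ k ih =>
    rw [show (∑ t : Fin (k + 1) → Bool, ξ ^ pc (List.ofFn t)) =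
        ∑ p : Bool × (Fin k → Bool), ξ ^ pc (List.ofFn (Fin.cons p.1 p.2 : Fin (k + 1) → Bool)) from
      ((Fin.consEquiv fun _ => Bool).sum_comp (fun t : Fin (k + 1) → Bool => ξ ^ pc (List.ofFn t))).symm,
      Fintype.sum_prod_type, Fintype.sum_bool]
    simp only [List.ofFn_cons, pc_cons, Bool.toNat_true, Bool.toNat_false, add_zero, pow_add, pow_one,
      ← Finset.sum_mul, ih]
    ring

/-! ### Event weights and event probabilities -/

/-- **The signed event weight** of an outcome: `+1` if wires `0` and `1` both read `1` (post-selected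
and accepting), `-1` if wire `1` reads `1` and wire `0` reads `0` (post-selected and rejecting), `0`
if wire `1` reads `0` (discarded run) — and `0` on registers with fewer than two wires. Summing
`c(z)|α_z|²` gives `Pr[11] − Pr[10] = 2·Pr[11] − Pr[·1]`, Aaronson's `S₁ − S₀`.
[cite: Aaronson2005, §3 Prop. 2 (proof: "the sum S₀ of α_z² over all z beginning with 10, or the sum S₁ of α_z² over all z beginning with 11")] -/
def evWt (z : QReg M) : ℤ :=
  if h : 1 < M then (if z ⟨1, h⟩ = true then (if z ⟨0, lt_trans zero_lt_one h⟩ = true then 1 else -1) else 0)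
  else 0

/-- The post-selection indicator weight `[z₁ = 1]` (zero on registers with fewer than two wires).
[cite: Aaronson2005, §3 Def. 1 (i)] -/
def psWt (z : QReg M) : ℤ :=
  if h : 1 < M then (if z ⟨1, h⟩ = true then 1 else 0) else 0

/-- The amplitude vector of the `ζ`-semantics on `|w⟩`. [folklore] -/
abbrev amp (ζ : ℂ) (gs : List (QGate cliffordT M)) (w : QReg M) : QReg M → ℂ :=
  prodZeta ζ gs *ᵥ basisState w

/-- **`Pr[·1]` of the `ζ`-semantics**: the Born sum over the post-selection event (wire `1` reads
`1`) — literally `Σ_{z ∈ postselectEvent} |a_z|²`. [cite: Aaronson2005, §3 Def. 1 (i)] -/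
def prS (ζ : ℂ) (gs : List (QGate cliffordT M)) (w : QReg M) : ℝ :=
  open scoped Classical in
  ∑ z : QReg M, if z ∈ QCircuit.postselectEvent M then ‖amp ζ gs w z‖ ^ 2 else 0

/-- **`Pr[11]` of the `ζ`-semantics**: the Born sum over the joint acceptance event (wires `0` and
`1` read `1`). [cite: Aaronson2005, §3 Def. 1 (ii)] -/
def prJ (ζ : ℂ) (gs : List (QGate cliffordT M)) (w : QReg M) : ℝ :=
  open scoped Classical in
  ∑ z : QReg M, if z ∈ QCircuit.jointAcceptEvent M then ‖amp ζ gs w z‖ ^ 2 else 0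

/-- **The weighted squared-amplitude sum** `uval ζ c = 2^h Σ_z c(z) |a_z|²` of the `ζ`-semantics
(`h` = number of Hadamard gates). [cite: AdlemanDeMarraisHuang1997, §6 Lemma 6.10 (proof, p. 1539: 2d^{2t}(Σ_{C∈C_A} amp² − Σ_{C∈C_R} amp²))] -/
def uval (ζ : ℂ) (c : QReg M → ℤ) (gs : List (QGate cliffordT M)) (w : QReg M) : ℝ :=
  ∑ z : QReg M, (c z : ℝ) * ((2 : ℝ) ^ hCount gs * ‖amp ζ gs w z‖ ^ 2)

/-- `uval ζ evWt = 2^h (2·Pr[11] − Pr[·1])`. [cite: Aaronson2005, §3 Prop. 2 (proof: S₁ versus S₀)] -/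
theorem uval_evWt (ζ : ℂ) (gs : List (QGate cliffordT M)) (w : QReg M) :
    uval ζ evWt gs w = (2 : ℝ) ^ hCount gs * (2 * prJ ζ gs w - prS ζ gs w) := by
  classical
  unfold uval prJ prS
  rw [mul_sub, Finset.mul_sum, Finset.mul_sum, Finset.mul_sum, ← Finset.sum_sub_distrib]
  refine Finset.sum_congr rfl fun z _ => ?_
  by_cases hM : 1 < M
  · have h0lt : 0 < M := lt_trans zero_lt_one hM
    by_cases h1 : z ⟨1, hM⟩ = true
    · have hzS : z ∈ QCircuit.postselectEvent M := ⟨hM, h1⟩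
      by_cases h0 : z ⟨0, h0lt⟩ = true
      · have hzJ : z ∈ QCircuit.jointAcceptEvent M := ⟨hM, h0, h1⟩
        rw [if_pos hzJ, if_pos hzS, evWt, dif_pos hM, if_pos h1, if_pos h0]
        push_cast; ring
      · have hzJ : z ∉ QCircuit.jointAcceptEvent M := fun ⟨_, h, _⟩ => h0 h
        rw [if_neg hzJ, if_pos hzS, evWt, dif_pos hM, if_pos h1, if_neg h0]
        push_cast; ring
    · have hzS : z ∉ QCircuit.postselectEvent M := fun ⟨_, h⟩ => h1 h
      have hzJ : z ∉ QCircuit.jointAcceptEvent M := fun ⟨_, _, h⟩ => h1 h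
      rw [if_neg hzJ, if_neg hzS, evWt, dif_pos hM, if_neg h1]
      push_cast; ring
  · have hzS : z ∉ QCircuit.postselectEvent M := fun ⟨h, _⟩ => hM h
    have hzJ : z ∉ QCircuit.jointAcceptEvent M := fun ⟨h, _⟩ => hM h
    rw [if_neg hzJ, if_neg hzS, evWt, dif_neg hM]
    push_cast; ring

/-- `uval ζ psWt = 2^h · Pr[·1]`. [cite: Aaronson2005, §3 Def. 1 (i)] -/
theorem uval_psWt (ζ : ℂ) (gs : List (QGate cliffordT M)) (w : QReg M) :
    uval ζ psWt gs w = (2 : ℝ) ^ hCount gs * prS ζ gs w := by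
  classical
  unfold uval prS
  rw [Finset.mul_sum]
  refine Finset.sum_congr rfl fun z _ => ?_
  by_cases hM : 1 < M
  · by_cases h1 : z ⟨1, hM⟩ = true
    · rw [if_pos (show z ∈ QCircuit.postselectEvent M from ⟨hM, h1⟩), psWt, dif_pos hM, if_pos h1]
      push_cast; ring
    · rw [if_neg (show z ∉ QCircuit.postselectEvent M from fun ⟨_, h⟩ => h1 h), psWt, dif_pos hM, if_neg h1]
      push_cast; ring
  · rw [if_neg (show z ∉ QCircuit.postselectEvent M from fun ⟨h, _⟩ => hM h), psWt, dif_neg hM]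
    push_cast; ring

/-- `0 ≤ Pr[11]`. [folklore] -/
theorem prJ_nonneg (ζ : ℂ) (gs : List (QGate cliffordT M)) (w : QReg M) : 0 ≤ prJ ζ gs w := by
  classical
  exact Finset.sum_nonneg fun z _ => by split_ifs <;> positivity

/-- `Pr[11] ≤ Pr[·1]` (event inclusion). [folklore] -/
theorem prJ_le_prS (ζ : ℂ) (gs : List (QGate cliffordT M)) (w : QReg M) : prJ ζ gs w ≤ prS ζ gs w := by
  classical
  unfold prJ prS
  refine Finset.sum_le_sum fun z _ => ?_
  by_cases hJ : z ∈ QCircuit.jointAcceptEvent M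
  · rw [if_pos hJ, if_pos (QCircuit.jointAcceptEvent_subset_postselectEvent M hJ)]
  · rw [if_neg hJ]; split_ifs <;> positivity

/-- `Pr[·1] ≤ 1` for `|ζ| = 1` (a sub-sum of the squared amplitudes of a unit vector). [folklore] -/
theorem prS_le_one {ζ : ℂ} (hζ : ζ * star ζ = 1) (gs : List (QGate cliffordT M)) (w : QReg M) :
    prS ζ gs w ≤ 1 := by
  classical
  rw [← normSq_prodZeta_mulVec_basisState hζ gs w, normSq]
  exact Finset.sum_le_sum fun z _ => by split_ifs <;> first | exact le_rfl | positivity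

/-- `|uval ζ evWt| ≤ 2^h` for `|ζ| = 1`: `2·Pr[11] − Pr[·1] ∈ [−Pr[·1], Pr[·1]] ⊆ [−1, 1]`. [folklore] -/
theorem abs_uval_evWt_le {ζ : ℂ} (hζ : ζ * star ζ = 1) (gs : List (QGate cliffordT M)) (w : QReg M) :
    |uval ζ evWt gs w| ≤ (2 : ℝ) ^ hCount gs := by
  rw [uval_evWt, abs_le]
  have h1 := prJ_nonneg ζ gs w
  have h2 := prJ_le_prS ζ gs w
  have h3 := prS_le_one hζ gs w
  have hpow : (0 : ℝ) < (2 : ℝ) ^ hCount gs := by positivity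
  constructor <;> nlinarith

/-! ### `uval` as an integer pair sum -/

/-- The `c`-weighted integer part `Σ_z c(z) · pairSumA(z)`. [cite: AdlemanDeMarraisHuang1997, §6 Lemma 6.10 (proof, p. 1539)] -/
def cA (c : QReg M → ℤ) (gs : List (QGate cliffordT M)) (w : QReg M) : ℤ :=
  ∑ z : QReg M, c z * pairSumA gs w z

/-- The `c`-weighted `√2/2`-part `Σ_z c(z) · pairSumB(z)`. [cite: AdlemanDeMarraisHuang1997, §6 Lemma 6.10 (proof, p. 1539)] -/
def cB (c : QReg M → ℤ) (gs : List (QGate cliffordT M)) (w : QReg M) : ℤ :=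
  ∑ z : QReg M, c z * pairSumB gs w z

/-- **`uval ζ c = cA + ε (√2/2) cB`** for `ζ` as in `two_pow_mul_normSq_amp` (`ε = 1` for `ω`,
`ε = -1` for the conjugate `ω⁵`). [cite: AdlemanDeMarraisHuang1997, §6 Lemma 6.10 (proof, p. 1539)] -/
theorem uval_eq_cA_add_cB {ζ : ℂ} (hζ2 : ζ ^ 2 = Complex.I) (h8 : ζ ^ 8 = 1) (hstar : star ζ = ζ ^ 7)
    {ε : ℝ} (hre : ∀ d < 8, (ζ ^ d).re = reA d + ε * reB d * (Real.sqrt 2 / 2))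
    (c : QReg M → ℤ) (gs : List (QGate cliffordT M)) (hgs : ∀ g ∈ gs, g.IsOracleFree) (w : QReg M) :
    uval ζ c gs w = (cA c gs w : ℝ) + ε * (Real.sqrt 2 / 2) * cB c gs w := by
  unfold uval cA cB
  simp only [two_pow_mul_normSq_amp hζ2 h8 hstar hre gs hgs w, Int.cast_sum, Int.cast_mul, Finset.mul_sum,
    ← Finset.sum_add_distrib]
  refine Finset.sum_congr rfl fun z _ => ?_
  ring

/-- **Post-selection probabilities of Clifford+T circuits are not too small**:
`2^h · Pr[·1] ≥ 1/2^{h+1}` whenever `Pr[·1] > 0`. With `s = 2^h Pr[·1] = a + b√2/2` and its Galois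
conjugate `s^σ = a − b√2/2 = 2^h Pr^σ[·1] ∈ [0, 2^h]` (the post-selection probability of the unitary
conjugate semantics), `s·s^σ = (2a² − b²)/2` is a nonzero half-integer (irrationality of `√2`), so
`s ≥ 1/(2 s^σ) ≥ 1/2^{h+1}`. This is the step where exactness replaces the dyadic rationals of the
printed proof. [cite: Aaronson2005, §3 Prop. 2 (proof: "each of which is a rational real number computable in classical polynomial time")] -/
theorem two_pow_mul_prS_ge (gs : List (QGate cliffordT M)) (hgs : ∀ g ∈ gs, g.IsOracleFree) (w : QReg M)
    (hS : 0 < prS omega gs w) :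
    1 / (2 : ℝ) ^ (hCount gs + 1) ≤ (2 : ℝ) ^ hCount gs * prS omega gs w := by
  have h1 := uval_eq_cA_add_cB (ε := 1) omega_pow_two omega_pow_eight star_omega
    (fun d hd => by rw [omega_pow_re d hd]; ring) psWt gs hgs w
  have h5 := uval_eq_cA_add_cB (ε := -1) omega5_pow_two omega5_pow_eight star_omega5
    (fun d hd => by rw [omega5_pow_re d hd]; ring) psWt gs hgs w
  rw [uval_psWt] at h1 h5
  set a : ℤ := cA psWt gs w with ha
  set b : ℤ := cB psWt gs w with hb
  set s : ℝ := (2 : ℝ) ^ hCount gs * prS omega gs w with hs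
  set s' : ℝ := (2 : ℝ) ^ hCount gs * prS (omega ^ 5) gs w with hs'
  have hpow : (0 : ℝ) < (2 : ℝ) ^ hCount gs := by positivity
  have hs_pos : 0 < s := mul_pos hpow hS
  have hs'_nonneg : 0 ≤ s' := by
    have : 0 ≤ prS (omega ^ 5) gs w := by
      classical
      exact Finset.sum_nonneg fun z _ => by split_ifs <;> positivity
    exact mul_nonneg hpow.le this
  have hs'_le : s' ≤ (2 : ℝ) ^ hCount gs := by
    have := prS_le_one omega5_mul_star gs w
    nlinarith
  have hsq : Real.sqrt 2 * Real.sqrt 2 = 2 := Real.mul_self_sqrt (by norm_num)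
  -- irrationality of `√2`: `a' + b' √2/2 = 0` forces `a' = b' = 0` (as `ZW.int_add_int_mul_sqrt_two_half_eq_zero`
  -- of `ZWRing.lean`, re-proved inline to keep the import closure small)
  have hirr0 : ∀ a' b' : ℤ, (a' : ℝ) + b' * (Real.sqrt 2 / 2) = 0 → a' = 0 ∧ b' = 0 := by
    intro a' b' h
    by_cases hb : b' = 0
    · subst hb
      simp at h
      exact ⟨by exact_mod_cast h, rfl⟩
    · exfalso
      have hirr := (irrational_iff_ne_rational _).1 irrational_sqrt_two (-2 * a') b' hb
      apply hirr
      have hb' : (b' : ℝ) ≠ 0 := by exact_mod_cast hb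
      field_simp
      push_cast
      linarith
  -- the norm `s s' = (2a² − b²)/2`
  have hnorm : 2 * (s * s') = ((2 * a ^ 2 - b ^ 2 : ℤ) : ℝ) := by
    rw [h1, h5]; push_cast; linear_combination (-(b : ℝ) ^ 2 / 2) * hsq
  -- `s' ≠ 0`
  have hs'_pos : 0 < s' := by
    rcases hs'_nonneg.lt_or_eq with h | h
    · exact h
    · exfalso
      have h0 : (a : ℝ) + (-b : ℤ) * (Real.sqrt 2 / 2) = 0 := by
        rw [← h] at h5; push_cast at h5 ⊢; linarith
      obtain ⟨ha0, hb0⟩ := hirr0 _ _ h0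
      have : s = 0 := by rw [h1, ha0, show b = 0 by omega]; simp
      exact absurd this hs_pos.ne'
  -- the norm is a positive integer, hence `≥ 1`
  have hN : (1 : ℝ) ≤ 2 * (s * s') := by
    have hpos : (0 : ℝ) < ((2 * a ^ 2 - b ^ 2 : ℤ) : ℝ) := by
      rw [← hnorm]; exact mul_pos two_pos (mul_pos hs_pos hs'_pos)
    have hpos' : (0 : ℤ) < 2 * a ^ 2 - b ^ 2 := by exact_mod_cast hpos
    have h1le : (1 : ℤ) ≤ 2 * a ^ 2 - b ^ 2 := by omega
    rw [hnorm]
    exact_mod_cast h1le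
  -- conclude
  rw [div_le_iff₀ (by positivity), pow_succ]
  calc (1 : ℝ) ≤ 2 * (s * s') := hN
    _ = s * s' * 2 := by ring
    _ ≤ s * ((2 : ℝ) ^ hCount gs * 2) := by nlinarith

/-! ### Extended phase classes and their weights -/

/-- **The extended phase-difference class** of a guessed quadruple `(b, b', t, t')`: if both paths
are valid and end at the same label `z`, the label and the class
`(φ + pc t − φ' − pc t') mod 8` (written with `7 ≡ −1`); otherwise `none`. Each coin `1` of `t`
(`t'`) prolongs the first (second) path by a factor `ω` (`ω̄` after conjugation).
[cite: Aaronson2005, §3 Prop. 2 (proof: the contributions a_{z,i} a_{z,j})] -/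
def extDiff (gs : List (QGate cliffordT M)) (w : QReg M) (bs bs' t t' : List Bool) : Option (QReg M × ℕ) :=
  match pathRun gs w bs, pathRun gs w bs' with
  | some (z₁, φ), some (z₂, φ') => if z₁ = z₂ then some (z₁, (φ + pc t + 7 * (φ' + pc t')) % 8) else none
  | _, _ => none

/-- Extended classes are residues mod `8`. [folklore] -/
theorem lt_of_extDiff_eq_some {gs : List (QGate cliffordT M)} {w : QReg M} {bs bs' t t' : List Bool}
    {z : QReg M} {D : ℕ} (h : extDiff gs w bs bs' t t' = some (z, D)) : D < 8 := by
  unfold extDiff at h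
  rcases h1 : pathRun gs w bs with _ | ⟨z₁, φ⟩ <;> rcases h2 : pathRun gs w bs' with _ | ⟨z₂, φ'⟩ <;>
    simp only [h1, h2] at h
  · exact absurd h (by simp)
  · exact absurd h (by simp)
  · exact absurd h (by simp)
  · by_cases hz : z₁ = z₂
    · rw [if_pos hz, Option.some.injEq, Prod.mk.injEq] at h
      obtain ⟨-, hD⟩ := h
      omega
    · rw [if_neg hz] at h
      exact absurd h (by simp)

/-- **The integer weight** `c(z) · reA(D) ∈ {0, ±c(z)}` of a quadruple — what the polynomial-time
predicate of `PostBQP ⊆ PP` computes (classes `0` and `4` count `±c(z)`, all others `0`).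
[cite: Aaronson2005, §3 Prop. 2 (proof: "we simply put the positive contributions … on one side of the ledger")] -/
def wtA (c : QReg M → ℤ) (gs : List (QGate cliffordT M)) (w : QReg M) (bs bs' t t' : List Bool) : ℤ :=
  match extDiff gs w bs bs' t t' with
  | some (z, D) => c z * reA D
  | none => 0

/-- The `√2/2`-weight `c(z) · reB(D)` of a quadruple (analysis only). [folklore] -/
def wtB (c : QReg M → ℤ) (gs : List (QGate cliffordT M)) (w : QReg M) (bs bs' t t' : List Bool) : ℤ :=
  match extDiff gs w bs bs' t t' with
  | some (z, D) => c z * reB D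
  | none => 0

/-- The complex term `c(z) · ζ^D` of a quadruple (analysis only). [folklore] -/
def termExt (ζ : ℂ) (c : QReg M → ℤ) (gs : List (QGate cliffordT M)) (w : QReg M)
    (bs bs' t t' : List Bool) : ℂ :=
  match extDiff gs w bs bs' t t' with
  | some (z, D) => ((c z : ℝ) : ℂ) * ζ ^ D
  | none => 0

/-- `|wtA| ≤ 1` for weights `c` with `|c| ≤ 1`. [folklore] -/
theorem abs_wtA_le {c : QReg M → ℤ} (hc : ∀ z, |c z| ≤ 1) (gs : List (QGate cliffordT M)) (w : QReg M)
    (bs bs' t t' : List Bool) : |wtA c gs w bs bs' t t'| ≤ 1 := by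
  unfold wtA
  rcases extDiff gs w bs bs' t t' with _ | ⟨z, D⟩
  · simp
  · simp only [abs_mul]
    have hA : |reA D| ≤ 1 := by
      rcases D with _ | _ | _ | _ | _ | _ | _ | _ | D <;> simp [reA]
    calc |c z| * |reA D| ≤ 1 * 1 := mul_le_mul (hc z) hA (abs_nonneg _) zero_le_one
      _ = 1 := one_mul 1

/-- `|evWt z| ≤ 1`. [folklore] -/
theorem abs_evWt_le_one (z : QReg M) : |evWt z| ≤ 1 := by
  unfold evWt; split_ifs <;> simp

/-- **The sum the `PP` machine counts**: `X = Σ_{b, b', t, t'} wtA` over path choices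
`b, b' ∈ {0,1}^{|gs|}` and phase coins `t, t' ∈ {0,1}^k`. [cite: Aaronson2005, §3 Prop. 2 (proof)] -/
def extX (c : QReg M → ℤ) (gs : List (QGate cliffordT M)) (w : QReg M) (k : ℕ) : ℤ :=
  ∑ b : Fin gs.length → Bool, ∑ b' : Fin gs.length → Bool, ∑ t : Fin k → Bool, ∑ t' : Fin k → Bool,
    wtA c gs w (List.ofFn b) (List.ofFn b') (List.ofFn t) (List.ofFn t')

/-- The `√2/2`-companion `Y = Σ wtB` of `X` (analysis only). [folklore] -/
def extY (c : QReg M → ℤ) (gs : List (QGate cliffordT M)) (w : QReg M) (k : ℕ) : ℤ :=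
  ∑ b : Fin gs.length → Bool, ∑ b' : Fin gs.length → Bool, ∑ t : Fin k → Bool, ∑ t' : Fin k → Bool,
    wtB c gs w (List.ofFn b) (List.ofFn b') (List.ofFn t) (List.ofFn t')

/-- The complex extended pair sum `Φ(ζ) = Σ termExt` (analysis only). [folklore] -/
def Phi (ζ : ℂ) (c : QReg M → ℤ) (gs : List (QGate cliffordT M)) (w : QReg M) (k : ℕ) : ℂ :=
  ∑ b : Fin gs.length → Bool, ∑ b' : Fin gs.length → Bool, ∑ t : Fin k → Bool, ∑ t' : Fin k → Bool,
    termExt ζ c gs w (List.ofFn b) (List.ofFn b') (List.ofFn t) (List.ofFn t')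

/-- Real part of a term: `Re(c ζ^D) = wtA + ε (√2/2) wtB`. [folklore] -/
theorem re_termExt {ζ : ℂ} {ε : ℝ} (hre : ∀ d < 8, (ζ ^ d).re = reA d + ε * reB d * (Real.sqrt 2 / 2))
    (c : QReg M → ℤ) (gs : List (QGate cliffordT M)) (w : QReg M) (bs bs' t t' : List Bool) :
    (termExt ζ c gs w bs bs' t t').re =
      (wtA c gs w bs bs' t t' : ℝ) + ε * (Real.sqrt 2 / 2) * wtB c gs w bs bs' t t' := by
  unfold termExt wtA wtB
  rcases hD : extDiff gs w bs bs' t t' with _ | ⟨z, D⟩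
  · simp
  · simp only [Complex.re_ofReal_mul, hre D (lt_of_extDiff_eq_some hD), Int.cast_mul]
    ring

/-- **Real part of `Φ`**: `Re Φ(ζ) = X + ε (√2/2) Y`. [folklore] -/
theorem re_Phi {ζ : ℂ} {ε : ℝ} (hre : ∀ d < 8, (ζ ^ d).re = reA d + ε * reB d * (Real.sqrt 2 / 2))
    (c : QReg M → ℤ) (gs : List (QGate cliffordT M)) (w : QReg M) (k : ℕ) :
    (Phi ζ c gs w k).re = (extX c gs w k : ℝ) + ε * (Real.sqrt 2 / 2) * extY c gs w k := by
  unfold Phi extX extY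
  simp only [Complex.re_sum, re_termExt hre, Int.cast_sum, Finset.mul_sum, ← Finset.sum_add_distrib]

/-! ### The factorisation of `Φ` -/

/-- **One term, factorised**: `termExt = (Σ_z c(z) · pathTerm_b(z) · conj pathTerm_{b'}(z)) · ζ^{pc t} · (ζ⁷)^{pc t'}`
for an eighth root of unity `ζ` with `conj ζ = ζ⁷`. [folklore] -/
theorem termExt_eq {ζ : ℂ} (h8 : ζ ^ 8 = 1) (hstar : star ζ = ζ ^ 7) (c : QReg M → ℤ)
    (gs : List (QGate cliffordT M)) (w : QReg M) (bs bs' t t' : List Bool) :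
    termExt ζ c gs w bs bs' t t' =
      (∑ z : QReg M, ((c z : ℝ) : ℂ) * (pathTerm ζ gs w z bs * star (pathTerm ζ gs w z bs'))) *
        (ζ ^ pc t * (ζ ^ 7) ^ pc t') := by
  unfold termExt extDiff pathTerm
  rcases pathRun gs w bs with _ | ⟨z₁, φ⟩ <;> rcases pathRun gs w bs' with _ | ⟨z₂, φ'⟩
  · simp
  · simp
  · simp
  · simp only
    by_cases hz : z₁ = z₂
    · subst hz
      rw [if_pos rfl]
      simp only
      rw [Finset.sum_eq_single z₁]
      · rw [if_pos rfl, if_pos rfl, star_pow, hstar, ← pow_mul, zeta_pow_mod_eight h8]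
        simp only [pow_add, pow_mul]
        ring
      · intro z _ hzz
        rw [if_neg (Ne.symm hzz)]
        simp
      · intro h; exact absurd (Finset.mem_univ _) h
    · rw [if_neg hz]
      simp only
      symm
      rw [mul_eq_zero]; left
      refine Finset.sum_eq_zero fun z _ => ?_
      by_cases h1 : z₁ = z
      · subst h1; rw [if_neg (Ne.symm hz)]; simp
      · rw [if_neg h1]; simp

/-- `2^h |a_z|² = |Σ_b pathTerm_b(z)|²` as a complex number: the squared path sum at `z`.
[cite: AdlemanDeMarraisHuang1997, §6 (p. 1535, amp = Σ_p ρ_p)] -/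
theorem sum_pathTerm_mul_star {ζ : ℂ} (hζ2 : ζ ^ 2 = Complex.I) (gs : List (QGate cliffordT M))
    (hgs : ∀ g ∈ gs, g.IsOracleFree) (w z : QReg M) :
    (∑ b : Fin gs.length → Bool, pathTerm ζ gs w z (List.ofFn b)) *
        star (∑ b' : Fin gs.length → Bool, pathTerm ζ gs w z (List.ofFn b')) =
      (((2 : ℝ) ^ hCount gs * ‖amp ζ gs w z‖ ^ 2 : ℝ) : ℂ) := by
  rw [Complex.star_def, Complex.mul_conj, Complex.normSq_eq_norm_sq]
  congr 1
  rw [show amp ζ gs w z = (prodZeta ζ gs *ᵥ basisState w) z from rfl,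
    prodZeta_mulVec_basisState_apply ζ hζ2 gs hgs w z, norm_mul, mul_pow, ← mul_assoc,
    two_pow_mul_norm_invSqrt2_pow_sq, one_mul]

/-- **Factorisation of `Φ`**: `Φ(ζ) = uval ζ c · ((1+ζ)(1+ζ⁷))^k` — the paths factor from the phase
coins, the coins of `t` contribute `(1+ζ)^k` and those of `t'` the conjugate `(1+ζ⁷)^k`. [folklore] -/
theorem Phi_eq {ζ : ℂ} (hζ2 : ζ ^ 2 = Complex.I) (h8 : ζ ^ 8 = 1) (hstar : star ζ = ζ ^ 7)
    (c : QReg M → ℤ) (gs : List (QGate cliffordT M)) (hgs : ∀ g ∈ gs, g.IsOracleFree) (w : QReg M) (k : ℕ) :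
    Phi ζ c gs w k = ((uval ζ c gs w : ℝ) : ℂ) * ((1 + ζ) * (1 + ζ ^ 7)) ^ k := by
  -- Step 1: factor each term and pull the coin factors out of the path sums.
  have step1 : Phi ζ c gs w k =
      (∑ b : Fin gs.length → Bool, ∑ b' : Fin gs.length → Bool,
          ∑ z : QReg M, ((c z : ℝ) : ℂ) * (pathTerm ζ gs w z (List.ofFn b) * star (pathTerm ζ gs w z (List.ofFn b')))) *
        ((∑ t : Fin k → Bool, ζ ^ pc (List.ofFn t)) * ∑ t' : Fin k → Bool, (ζ ^ 7) ^ pc (List.ofFn t')) := by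
    unfold Phi
    simp only [termExt_eq h8 hstar]
    rw [Finset.sum_mul]
    refine Finset.sum_congr rfl fun b _ => ?_
    rw [Finset.sum_mul]
    refine Finset.sum_congr rfl fun b' _ => ?_
    rw [Finset.sum_mul_sum, Finset.mul_sum]
    refine Finset.sum_congr rfl fun t _ => ?_
    rw [Finset.mul_sum]
  -- Step 2: the path double sum is `uval`.
  have step2 : (∑ b : Fin gs.length → Bool, ∑ b' : Fin gs.length → Bool,
      ∑ z : QReg M, ((c z : ℝ) : ℂ) * (pathTerm ζ gs w z (List.ofFn b) * star (pathTerm ζ gs w z (List.ofFn b')))) =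
      ((uval ζ c gs w : ℝ) : ℂ) := by
    simp only [Finset.sum_comm (α := QReg M)]
    unfold uval
    rw [Complex.ofReal_sum]
    refine Finset.sum_congr rfl fun z _ => ?_
    rw [Complex.ofReal_mul, ← sum_pathTerm_mul_star hζ2 gs hgs w z, star_sum, Finset.sum_mul_sum, Finset.mul_sum]
    refine Finset.sum_congr rfl fun b _ => ?_
    rw [Finset.mul_sum]
  rw [step1, step2, sum_pow_pc, sum_pow_pc, mul_pow]

/-- `(1 + ω)(1 + ω⁷) = 2 + √2`. [folklore] -/
theorem one_add_omega_mul : (1 + omega) * (1 + omega ^ 7) = ((2 + Real.sqrt 2 : ℝ) : ℂ) := by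
  have hsq : Real.sqrt 2 * Real.sqrt 2 = 2 := Real.mul_self_sqrt (by norm_num)
  rw [← star_omega, Complex.star_def]
  apply Complex.ext
  · simp only [Complex.mul_re, Complex.add_re, Complex.one_re, Complex.conj_re, Complex.add_im,
      Complex.one_im, Complex.conj_im, omega_re, omega_im, Complex.ofReal_re]
    linear_combination (1 / 2 : ℝ) * hsq
  · simp only [Complex.mul_im, Complex.add_re, Complex.one_re, Complex.conj_re, Complex.add_im,
      Complex.one_im, Complex.conj_im, omega_re, omega_im, Complex.ofReal_im]
    ring

/-- `(1 + ω⁵)(1 + (ω⁵)⁷) = 2 − √2`. [folklore] -/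
theorem one_add_omega5_mul : (1 + omega ^ 5) * (1 + (omega ^ 5) ^ 7) = ((2 - Real.sqrt 2 : ℝ) : ℂ) := by
  have hsq : Real.sqrt 2 * Real.sqrt 2 = 2 := Real.mul_self_sqrt (by norm_num)
  rw [← star_omega5, Complex.star_def]
  have h5 : omega ^ 5 = -omega := by rw [pow_succ, omega_pow_four]; ring
  have h5re : (omega ^ 5).re = -(Real.sqrt 2 / 2) := by rw [h5, Complex.neg_re, omega_re]
  have h5im : (omega ^ 5).im = -(Real.sqrt 2 / 2) := by rw [h5, Complex.neg_im, omega_im]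
  apply Complex.ext
  · simp only [Complex.mul_re, Complex.add_re, Complex.one_re, Complex.conj_re, Complex.add_im,
      Complex.one_im, Complex.conj_im, h5re, h5im, Complex.ofReal_re]
    linear_combination (1 / 2 : ℝ) * hsq
  · simp only [Complex.mul_im, Complex.add_re, Complex.one_re, Complex.conj_re, Complex.add_im,
      Complex.one_im, Complex.conj_im, h5re, h5im, Complex.ofReal_im]
    ring

/-- **`X + (√2/2) Y = u (2+√2)^k`** (`ζ = ω`). [folklore] -/
theorem extX_add_extY_omega (c : QReg M → ℤ) (gs : List (QGate cliffordT M)) (hgs : ∀ g ∈ gs, g.IsOracleFree)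
    (w : QReg M) (k : ℕ) :
    (extX c gs w k : ℝ) + (Real.sqrt 2 / 2) * extY c gs w k = uval omega c gs w * (2 + Real.sqrt 2) ^ k := by
  have h := congrArg Complex.re (Phi_eq omega_pow_two omega_pow_eight star_omega c gs hgs w k)
  rw [re_Phi (ε := 1) (fun d hd => by rw [omega_pow_re d hd]; ring), one_add_omega_mul,
    ← Complex.ofReal_pow, ← Complex.ofReal_mul, Complex.ofReal_re] at h
  linarith

/-- **`X − (√2/2) Y = u^σ (2−√2)^k`** (the conjugate `ζ = ω⁵`). [folklore] -/
theorem extX_sub_extY_omega5 (c : QReg M → ℤ) (gs : List (QGate cliffordT M)) (hgs : ∀ g ∈ gs, g.IsOracleFree)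
    (w : QReg M) (k : ℕ) :
    (extX c gs w k : ℝ) - (Real.sqrt 2 / 2) * extY c gs w k = uval (omega ^ 5) c gs w * (2 - Real.sqrt 2) ^ k := by
  have h := congrArg Complex.re (Phi_eq omega5_pow_two omega5_pow_eight star_omega5 c gs hgs w k)
  rw [re_Phi (ε := -1) (fun d hd => by rw [omega5_pow_re d hd]; ring), one_add_omega5_mul,
    ← Complex.ofReal_pow, ← Complex.ofReal_mul, Complex.ofReal_re] at h
  linarith

/-- **The trace identity** `2X = u (2+√2)^k + u^σ (2−√2)^k`. [folklore] -/
theorem two_mul_extX_eq (c : QReg M → ℤ) (gs : List (QGate cliffordT M)) (hgs : ∀ g ∈ gs, g.IsOracleFree)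
    (w : QReg M) (k : ℕ) :
    2 * (extX c gs w k : ℝ) =
      uval omega c gs w * (2 + Real.sqrt 2) ^ k + uval (omega ^ 5) c gs w * (2 - Real.sqrt 2) ^ k := by
  have h1 := extX_add_extY_omega c gs hgs w k
  have h2 := extX_sub_extY_omega5 c gs hgs w k
  linarith

/-! ### The sign theorem -/

/-- `(2 − √2)(3 + 2√2) = 2 + √2`. [folklore] -/
theorem two_sub_sqrt_mul : (2 - Real.sqrt 2) * (3 + 2 * Real.sqrt 2) = 2 + Real.sqrt 2 := by
  nlinarith [Real.mul_self_sqrt (show (0:ℝ) ≤ 2 by norm_num)]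

/-- `0 < 2 − √2`. [folklore] -/
theorem two_sub_sqrt_pos : 0 < 2 - Real.sqrt 2 := by linarith [sqrt_two_lt]

/-- **Growth of the multiplier**: `6 · 4^h · (2−√2)^k < (2+√2)^k` for `k ≥ h + 2`
(as `(2+√2)/(2−√2) = 3+2√2 ≥ 5`). [folklore] -/
theorem six_mul_lt {h k : ℕ} (hk : h + 2 ≤ k) :
    6 * (4 : ℝ) ^ h * (2 - Real.sqrt 2) ^ k < (2 + Real.sqrt 2) ^ k := by
  have hs := sqrt_two_gt
  have h5 : (5 : ℝ) ≤ 3 + 2 * Real.sqrt 2 := by linarith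
  have hA : 6 * (4 : ℝ) ^ h < (3 + 2 * Real.sqrt 2) ^ k := by
    calc 6 * (4 : ℝ) ^ h < 25 * 4 ^ h := by
          have : (0 : ℝ) < 4 ^ h := by positivity
          nlinarith
      _ ≤ 25 * 5 ^ h := by gcongr; norm_num
      _ = 5 ^ (h + 2) := by ring
      _ ≤ 5 ^ k := pow_le_pow_right₀ (by norm_num) hk
      _ ≤ (3 + 2 * Real.sqrt 2) ^ k := pow_le_pow_left₀ (by norm_num) h5 k
  have hpos : (0 : ℝ) < (2 - Real.sqrt 2) ^ k := pow_pos two_sub_sqrt_pos k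
  calc 6 * (4 : ℝ) ^ h * (2 - Real.sqrt 2) ^ k < (3 + 2 * Real.sqrt 2) ^ k * (2 - Real.sqrt 2) ^ k :=
        mul_lt_mul_of_pos_right hA hpos
    _ = ((2 - Real.sqrt 2) * (3 + 2 * Real.sqrt 2)) ^ k := by rw [mul_pow]; ring
    _ = (2 + Real.sqrt 2) ^ k := by rw [two_sub_sqrt_mul]

/-- The conjugate contribution is dominated: `|u^σ (2−√2)^k| ≤ 2^h (2−√2)^k`. [folklore] -/
theorem abs_conj_term_le (gs : List (QGate cliffordT M)) (w : QReg M) (k : ℕ) :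
    |uval (omega ^ 5) evWt gs w * (2 - Real.sqrt 2) ^ k| ≤ (2 : ℝ) ^ hCount gs * (2 - Real.sqrt 2) ^ k := by
  rw [abs_mul, abs_of_pos (pow_pos two_sub_sqrt_pos k)]
  exact mul_le_mul_of_nonneg_right (abs_uval_evWt_le omega5_mul_star gs w) (pow_pos two_sub_sqrt_pos k).le

/-- **Sign of the count, accepting case.** If `Pr[·1] > 0` and `Pr[11] ≥ (2/3)·Pr[·1]` (conditional
acceptance probability `≥ 2/3`) then `X > 0`, for `k ≥ h + 2` phase coins:
`2X = u(2+√2)^k + u^σ(2−√2)^k` with `u ≥ 2^h Pr[·1]/3 ≥ 1/(6·2^h)` and `|u^σ| ≤ 2^h`.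
[cite: Aaronson2005, §3 Prop. 2 (proof: "We need to test which is greater … we can do this in PP")] -/
theorem extX_pos (gs : List (QGate cliffordT M)) (hgs : ∀ g ∈ gs, g.IsOracleFree) (w : QReg M) {k : ℕ}
    (hk : hCount gs + 2 ≤ k) (hS : 0 < prS omega gs w) (hJ : 2 / 3 * prS omega gs w ≤ prJ omega gs w) :
    0 < extX evWt gs w k := by
  have h2X := two_mul_extX_eq evWt gs hgs w k
  have hu : uval omega evWt gs w = (2 : ℝ) ^ hCount gs * (2 * prJ omega gs w - prS omega gs w) := uval_evWt _ _ _
  have hlow := two_pow_mul_prS_ge gs hgs w hS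
  have hconj := abs_le.1 (abs_conj_term_le gs w k)
  have hsix := six_mul_lt hk
  have hpow : (0 : ℝ) < (2 : ℝ) ^ hCount gs := by positivity
  have hm : (0 : ℝ) < (2 + Real.sqrt 2) ^ k := pow_pos (by linarith [sqrt_two_gt]) k
  -- `u ≥ 2^h Pr[·1] / 3`
  have hu' : (2 : ℝ) ^ hCount gs * prS omega gs w / 3 ≤ uval omega evWt gs w := by rw [hu]; nlinarith
  -- `2^h Pr[·1] ≥ 1/2^{h+1}`, so `u (2+√2)^k ≥ (2+√2)^k / (6 · 2^h) > 2^h (2−√2)^k`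
  have hkey : (2 : ℝ) ^ hCount gs * (2 - Real.sqrt 2) ^ k < uval omega evWt gs w * (2 + Real.sqrt 2) ^ k := by
    have h1 : 1 / (2 : ℝ) ^ (hCount gs + 1) / 3 * (2 + Real.sqrt 2) ^ k ≤
        uval omega evWt gs w * (2 + Real.sqrt 2) ^ k := by
      apply mul_le_mul_of_nonneg_right _ hm.le
      linarith
    refine lt_of_lt_of_le ?_ h1
    rw [show (4 : ℝ) ^ hCount gs = 2 ^ hCount gs * 2 ^ hCount gs by rw [← mul_pow]; norm_num] at hsix
    rw [div_div, div_mul_eq_mul_div, lt_div_iff₀ (by positivity), pow_succ]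
    linarith
  have : (0 : ℝ) < 2 * (extX evWt gs w k : ℝ) := by rw [h2X]; linarith
  exact_mod_cast (show (0 : ℝ) < extX evWt gs w k by linarith)

/-- **Sign of the count, rejecting case.** If `Pr[·1] > 0` and `Pr[11] ≤ (1/3)·Pr[·1]` then `X < 0`,
for `k ≥ h + 2`. [cite: Aaronson2005, §3 Prop. 2 (proof)] -/
theorem extX_neg (gs : List (QGate cliffordT M)) (hgs : ∀ g ∈ gs, g.IsOracleFree) (w : QReg M) {k : ℕ}
    (hk : hCount gs + 2 ≤ k) (hS : 0 < prS omega gs w) (hJ : prJ omega gs w ≤ 1 / 3 * prS omega gs w) :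
    extX evWt gs w k < 0 := by
  have h2X := two_mul_extX_eq evWt gs hgs w k
  have hu : uval omega evWt gs w = (2 : ℝ) ^ hCount gs * (2 * prJ omega gs w - prS omega gs w) := uval_evWt _ _ _
  have hlow := two_pow_mul_prS_ge gs hgs w hS
  have hconj := abs_le.1 (abs_conj_term_le gs w k)
  have hsix := six_mul_lt hk
  have hpow : (0 : ℝ) < (2 : ℝ) ^ hCount gs := by positivity
  have hm : (0 : ℝ) < (2 + Real.sqrt 2) ^ k := pow_pos (by linarith [sqrt_two_gt]) k
  have hu' : uval omega evWt gs w ≤ -((2 : ℝ) ^ hCount gs * prS omega gs w / 3) := by rw [hu]; nlinarith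
  have hkey : uval omega evWt gs w * (2 + Real.sqrt 2) ^ k < -((2 : ℝ) ^ hCount gs * (2 - Real.sqrt 2) ^ k) := by
    have h1 : uval omega evWt gs w * (2 + Real.sqrt 2) ^ k ≤
        -(1 / (2 : ℝ) ^ (hCount gs + 1) / 3) * (2 + Real.sqrt 2) ^ k := by
      apply mul_le_mul_of_nonneg_right _ hm.le
      linarith
    refine lt_of_le_of_lt h1 ?_
    rw [show (4 : ℝ) ^ hCount gs = 2 ^ hCount gs * 2 ^ hCount gs by rw [← mul_pow]; norm_num] at hsix
    rw [neg_mul, neg_lt_neg_iff, div_div, div_mul_eq_mul_div, lt_div_iff₀ (by positivity), pow_succ]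
    linarith
  have : 2 * (extX evWt gs w k : ℝ) < 0 := by rw [h2X]; linarith
  exact_mod_cast (show (extX evWt gs w k : ℝ) < 0 by linarith)

end PostPP

end Literature.Computability.QuantumComplexity
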